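import Literature.MathematicalPhysics.QuantumLattice.TorusSectorPartitionFnTiling
import Literature.MathematicalPhysics.QuantumLattice.TorusSectorGibbsEnergyWindow
import HarnessLib

/-!
# Certified thermal energy windows from open-cluster partition functions (torus-limit thermal convention)

Family `hubbard` (topic `MathematicalPhysics/QuantumLattice`). END-TO-END composition of the free-energy
route for the `T > 0` certificate family of the Hubbard cell (sr-mbsolver/hubbard-thermal, technique (ii)):

  `TorusSectorPartitionFnTiling` (torus ≥ product of open boxes, canonical)  +  `SpinSectorPartitionFnRelabel`
  (square torus `(ℤ/Lℤ)²` = rectangular torus `L × L`)  +  `TorusSectorGibbsEnergyWindow` (chords of the sector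
  free energy bound the thermal energy density of every torus limit of the canonical Gibbs states).

§1 `(ℤ/Lℤ)² = L × L` for canonical partition functions of the `t–t'` Hamiltonian
(`partitionFn_spinSector_hubbardTorusTT'_eq_rect`; the diagonal-bond half of the graph isomorphism
`squareToRect` is private in `HubbardNNNHoppingRectSymmetries` and is re-derived here), and the bridge to the
sector compression of the thermal convention: `Z_β(sectorHamiltonianTT' t t' U n L) = Z_β(hubbardTorusTT' L; k, k)`,
`k = halfRectN n L` (`partitionFn_sectorHamiltonianTT'_eq_spinSector`; the two sides carry different — but
subsingleton — decidability instances).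
§2 FINITE VOLUME: if `L = K a` with `K ≥ 2` and the sector fits the boxes, `halfRectN n L = K² a₀`, then
`K² · log Re Z_β(H^open_{a×a}; a₀, a₀) ≤ log Re Z_β(sectorHamiltonianTT' t t' U n L)`
(`sq_mul_log_partitionFn_openBox_le_sectorHamiltonianTT'`).
§3 THERMODYNAMIC LIMIT: for every torus limit `ω` of the canonical sector Gibbs states at `β > 0` along tori
made of `a × a` boxes with `a₀ + a₀` electrons each, and every certified lower bound `0 < z ≤ Re Z_β(H^open; a₀, a₀)`:
* `…le_entropy_sub_log_openBox_div_of_sectorGibbs` — **from ONE box partition function alone**: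
  `e_Φ(ω) ≤ (s − log z / a²)/β` whenever `2 H_b(n/2) < s` (the infinite-temperature chord with the box free
  energy; improves the kinematic cap exactly by the box's entropy gain);
* `…le_chord_openBox_of_sectorGibbs` — **with a hot free-energy lower bound** `log Z_{L,β_h} ≤ u_h L²`
  (`0 < β_h < β`): `e_Φ(ω) ≤ (u_h − log z / a²)/(β − β_h)`.
The lower edge `e(t,t',U,n) ≤ e_Φ(ω)` is the cut row of `TorusSectorGibbsMixture`.

Everything is PROVED; no definition, no named fact.

## References

* D. Ruelle, *Statistical Mechanics: Rigorous Results* (1969), §2.5–2.6, §3.3. [cite: Ruelle1969, §3.3]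
* R. B. Israel, *Convexity in the Theory of Lattice Gases* (1979), Lemma II.3.1. [cite: Israel1979, Lemma II.3.1]
* F. H. L. Essler et al., *The One-Dimensional Hubbard Model* (2005), §2.2.1 eqs. (2.32)–(2.39) (site
  relabellings act unitarily on Fock space). [cite: EsslerEtAl2005, §2.2.1 eqs. (2.32)–(2.39)]
-/

noncomputable section

namespace Literature.MathematicalPhysics.QuantumLattice

open Matrix Finset HubbardWave0 ThermodynamicLimit LiebThm1 Literature.Probability.LatticeModels
open _root_.Filter
open scoped _root_.Topology ComplexOrder BigOperators

/-! ### §1 Square torus = rectangular torus; the bridge to `sectorHamiltonianTT'` -/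

section SquareRect

/-- `ringAdj` of representatives `u, v < L`, read in `ZMod L` (re-derived; private in
`HubbardNNNHoppingRectSymmetries`). [folklore] -/
private theorem ringAdj_iff_zmod' {L : ℕ} (u v : Fin L) :
    ringAdj L u v ↔ ((u : ℕ) : ZMod L) ≠ ((v : ℕ) : ZMod L) ∧
      (((v : ℕ) : ZMod L) = ((u : ℕ) : ZMod L) + 1 ∨
        ((u : ℕ) : ZMod L) = ((v : ℕ) : ZMod L) + 1) := by
  have hinj : ((u : ℕ) : ZMod L) = ((v : ℕ) : ZMod L) ↔ u = v := by
    rw [ZMod.natCast_eq_natCast_iff', Nat.mod_eq_of_lt u.isLt, Nat.mod_eq_of_lt v.isLt]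
    exact Fin.val_inj
  rw [ringAdj, zmod_natCast_eq_add_one_iff u v, zmod_natCast_eq_add_one_iff v u, ne_eq, ne_eq, hinj,
    Fin.val_inj]

/-- The diagonal jumps in coordinates (re-derived). [folklore] -/
private theorem exists_eq_add_torusDiagJump_iff' {L : ℕ} (X Y : TorusSite 2 L) :
    (∃ s : Fin 2, Y = X + torusDiagJump L s) ↔
      Y 0 = X 0 + 1 ∧ (Y 1 = X 1 + 1 ∨ X 1 = Y 1 + 1) := by
  constructor
  · rintro ⟨s, rfl⟩
    refine ⟨by simp [torusDiagJump], ?_⟩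
    fin_cases s
    · exact Or.inl (by simp [torusDiagJump])
    · exact Or.inr (by simp [torusDiagJump])
  · rintro ⟨h0, h1 | h1⟩
    · refine ⟨0, funext fun i => ?_⟩
      fin_cases i
      · simpa [torusDiagJump] using h0
      · simpa [torusDiagJump] using h1
    · refine ⟨1, funext fun i => ?_⟩
      fin_cases i
      · simpa [torusDiagJump] using h0
      · show Y 1 = X 1 + torusDiagJump L 1 1
        rw [h1]
        simp [torusDiagJump]

/-- Non-degeneracy of a diagonal step between distinct points (re-derived). [folklore] -/
private theorem ne_and_ne_of_diagStep' {L : ℕ} {X Y : TorusSite 2 L} (hXY : X ≠ Y)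
    (h0 : Y 0 = X 0 + 1) (h1 : Y 1 = X 1 + 1 ∨ X 1 = Y 1 + 1) : X 0 ≠ Y 0 ∧ X 1 ≠ Y 1 := by
  have degen : (1 : ZMod L) = 0 → False := by
    intro h10
    apply hXY
    funext i
    fin_cases i
    · show X 0 = Y 0
      rw [h0, h10, add_zero]
    · show X 1 = Y 1
      rcases h1 with h | h
      · rw [h, h10, add_zero]
      · rw [h, h10, add_zero]
  constructor
  · intro heq
    rw [heq] at h0
    exact degen (by simpa using h0.symm)
  · intro heq
    rcases h1 with h | h
    · rw [heq] at h; exact degen (by simpa using h.symm)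
    · rw [heq] at h; exact degen (by simpa using h.symm)

/-- `squareToRect` carries the DIAGONAL adjacency of `(ℤ/Lℤ)²` onto that of the rectangular torus `L × L`
(re-derived; private in `HubbardNNNHoppingRectSymmetries`). [cite: EsslerEtAl2005, §2.2.1 eqs. (2.32)–(2.39)] -/
theorem fermionRectTorusDiagGraph_adj_squareToRect' {L : ℕ} (x y : FermionTorus 2 L) :
    (fermionRectTorusDiagGraph L L).Adj (squareToRect L x) (squareToRect L y) ↔
      (fermionTorusDiagGraph L).Adj x y := by
  rw [fermionRectTorusDiagGraph_adj_iff, ofLex_squareToRect_fst, ofLex_squareToRect_snd,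
    ofLex_squareToRect_fst, ofLex_squareToRect_snd, ringAdj_iff_zmod', ringAdj_iff_zmod']
  change ((FermionTorus.toTorusSite x 0 ≠ FermionTorus.toTorusSite y 0 ∧ _) ∧
      (FermionTorus.toTorusSite x 1 ≠ FermionTorus.toTorusSite y 1 ∧ _)) ↔
    (torusDiagGraph L).Adj (FermionTorus.toTorusSite x) (FermionTorus.toTorusSite y)
  rw [torusDiagGraph, SimpleGraph.fromRel_adj, exists_eq_add_torusDiagJump_iff',
    exists_eq_add_torusDiagJump_iff']
  set X := FermionTorus.toTorusSite x
  set Y := FermionTorus.toTorusSite y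
  constructor
  · rintro ⟨⟨hne0, h0 | h0⟩, ⟨-, h1⟩⟩
    · exact ⟨fun h => hne0 (congrFun h 0), Or.inl ⟨h0, h1⟩⟩
    · exact ⟨fun h => hne0 (congrFun h 0), Or.inr ⟨h0, h1.symm⟩⟩
  · rintro ⟨hXY, ⟨h0, h1⟩ | ⟨h0, h1⟩⟩
    · obtain ⟨hne0, hne1⟩ := ne_and_ne_of_diagStep' hXY h0 h1
      exact ⟨⟨hne0, Or.inl h0⟩, ⟨hne1, h1⟩⟩
    · obtain ⟨hne0, hne1⟩ := ne_and_ne_of_diagStep' hXY.symm h0 h1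
      exact ⟨⟨hne0.symm, Or.inr h0⟩, ⟨hne1.symm, h1.symm⟩⟩

/-- **`(ℤ/Lℤ)² = L × L` for canonical partition functions**: the canonical partition functions of the
square-torus `t–t'` Hamiltonian `hubbardTorusTT' L t t' U` are those of the rectangular torus
`hubbardRectTorusTT' L L t t' U` (site relabelling along `squareToRect`).
[cite: EsslerEtAl2005, §2.2.1 eqs. (2.32)–(2.39)] -/
theorem partitionFn_spinSector_hubbardTorusTT'_eq_rect (L : ℕ) (t t' U β : ℝ) (a b : ℕ) :
    partitionFn β (spinSectorHamiltonian a b (hubbardTorusTT' L t t' U)) =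
      partitionFn β (spinSectorHamiltonian a b (hubbardRectTorusTT' L L t t' U)) := by
  unfold hubbardTorusTT' hubbardRectTorusTT'
  exact (partitionFn_spinSector_hamiltonian₂_eq_of_iso (squareToRect L) (fermionTorusGraph 2 L)
    (fermionTorusDiagGraph L) (fermionRectTorusGraph L L) (fermionRectTorusDiagGraph L L)
    fermionRectTorusGraph_adj_squareToRect fermionRectTorusDiagGraph_adj_squareToRect' t U t' 0 β a b).symm

/-- **The bridge to the thermal convention**: the sector compression `sectorHamiltonianTT'` of
`TorusSectorGibbsEnergyWindow` IS `spinSectorHamiltonian k k (hubbardTorusTT' L t t' U)`, `k = halfRectN n L`,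
and their partition functions agree (the two sides carry different decidability instances on the same
configuration type; these are subsingletons). [cite: Israel1979, Lemma II.3.1] -/
theorem partitionFn_sectorHamiltonianTT'_eq_spinSector (β t t' U n : ℝ) (L : ℕ) :
    partitionFn β (sectorHamiltonianTT' t t' U n L) =
      partitionFn β (spinSectorHamiltonian (halfRectN n L) (halfRectN n L) (hubbardTorusTT' L t t' U)) := by
  unfold sectorHamiltonianTT' spinSectorHamiltonian
  congr 1

end SquareRect

/-! ### §2 Finite volume: an open box bounds the torus sector free energy -/

section FiniteVolume

/-- **Box ⇒ torus, thermal convention, finite volume.** Let `L = K a` with `K ≥ 2` and suppose the canonical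
sector fits the boxes, `halfRectN n L = K² a₀` (`a₀ ≤ a²`). Then for `β ≥ 0`
`K² · log Re Z_β(H^open_{a×a}(t,t',U); a₀, a₀) ≤ log Re Z_β(sectorHamiltonianTT' t t' U n L)`: per site, the
canonical free energy of the torus is at most that of the open box. [cite: Ruelle1969, §3.3]
[cite: Israel1979, Lemma II.3.1] -/
theorem sq_mul_log_partitionFn_openBox_le_sectorHamiltonianTT' (t t' U n : ℝ) {β : ℝ} (hβ : 0 ≤ β)
    {a K L a₀ : ℕ} (hK : 2 ≤ K) (hL : L = K * a) (ha₀ : a₀ ≤ a * a) (hsec : halfRectN n L = K * K * a₀) :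
    (K : ℝ) ^ 2 * Real.log (partitionFn β (spinSectorHamiltonian a₀ a₀ (hubbardOpenBoxTT' a a t t' U))).re ≤
      Real.log (partitionFn β (sectorHamiltonianTT' t t' U n L)).re := by
  have h := mul_log_partitionFn_openBox_le_rectTorus a a K K hK hK t t' U hβ ha₀ ha₀
  rw [partitionFn_sectorHamiltonianTT'_eq_spinSector, partitionFn_spinSector_hubbardTorusTT'_eq_rect, hsec, hL]
  rw [sq]
  exact h

end FiniteVolume

/-! ### §3 Thermodynamic limit: certified upper bounds on the thermal energy density from one box -/

namespace InfVolFermionState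

variable {t t' U n β : ℝ} {ω : InfVolFermionState 2} {Ls : ℕ → ℕ}

/-- **Per-site free-energy bound along box-built tori.** If eventually `Ls j = K_j a` with `K_j ≥ 2` and
`halfRectN n (Ls j) = K_j² a₀`, and `0 < z ≤ Re Z_β(H^open_{a×a}; a₀, a₀)` (`β ≥ 0`, `a ≥ 1`, `a₀ ≤ a²`), then
eventually `(log z / a²) · L² ≤ log Re Z_β(sectorHamiltonianTT' t t' U n L)` along `L = Ls j` — the
hypothesis `hℓ` of the chord theorems with `ℓ = log z / a²`. [cite: Ruelle1969, §3.3] [cite: Israel1979, Lemma II.3.1] -/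
theorem eventually_log_openBox_mul_sq_le_log_partitionFn (t t' U n : ℝ) {β : ℝ} (hβ : 0 ≤ β)
    {a a₀ : ℕ} (ha : 1 ≤ a) (ha₀ : a₀ ≤ a * a) {z : ℝ} (hz0 : 0 < z)
    (hz : z ≤ (partitionFn β (spinSectorHamiltonian a₀ a₀ (hubbardOpenBoxTT' a a t t' U))).re)
    (hbox : ∀ᶠ j in atTop, ∃ K, 2 ≤ K ∧ Ls j = K * a ∧ halfRectN n (Ls j) = K * K * a₀) :
    ∀ᶠ j in atTop, Real.log z / (a : ℝ) ^ 2 * (Ls j : ℝ) ^ 2 ≤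
      Real.log (partitionFn β (sectorHamiltonianTT' t t' U n (Ls j))).re := by
  filter_upwards [hbox] with j hj
  obtain ⟨K, hK, hLj, hsec⟩ := hj
  have h := sq_mul_log_partitionFn_openBox_le_sectorHamiltonianTT' t t' U n hβ hK hLj ha₀ hsec
  have ha' : (0 : ℝ) < (a : ℝ) ^ 2 := by positivity
  have hlogz : Real.log z ≤
      Real.log (partitionFn β (spinSectorHamiltonian a₀ a₀ (hubbardOpenBoxTT' a a t t' U))).re :=
    Real.log_le_log hz0 hz
  have hK2 : (0 : ℝ) ≤ (K : ℝ) ^ 2 := sq_nonneg _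
  calc Real.log z / (a : ℝ) ^ 2 * (Ls j : ℝ) ^ 2 = (K : ℝ) ^ 2 * Real.log z := by
        rw [hLj]; push_cast; field_simp
    _ ≤ (K : ℝ) ^ 2 *
        Real.log (partitionFn β (spinSectorHamiltonian a₀ a₀ (hubbardOpenBoxTT' a a t t' U))).re :=
        mul_le_mul_of_nonneg_left hlogz hK2
    _ ≤ _ := h

/-- **Certified upper bound on the thermal energy density from ONE open-box partition function** (torus-limit
thermal convention). Let `ω` be a torus limit of the canonical sector Gibbs states of the `t–t'` Hubbard model
at inverse temperature `β > 0` and filling `n ∈ [0, 2]` along tori `Ls j = K_j a` built of `a × a` boxes whose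
sector is `K_j²`-fold the box sector `(a₀, a₀)`. If `0 < z ≤ Re Z_β(H^open_{a×a}(t,t',U); a₀, a₀)` (an exactly
evaluated, or Peierls-certified, box partition function) and `2 H_b(n/2) < s` (sector entropy density), then
`e_{Φ(t,t',U)}(ω) ≤ (s − log z / a²)/β` — the infinite-temperature chord of `log Z` anchored at the box free
energy, i.e. `e ≤ f_box + T·s`. [cite: Israel1979, Lemma II.3.1] [cite: Ruelle1969, §2.5–2.6] -/
theorem IsTorusLimitOfMixture.meanEnergy_hubbardTTPrime_le_entropy_sub_log_openBox_div_of_sectorGibbs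
    (hn0 : 0 ≤ n) (hn2 : n ≤ 2)
    (h : ω.IsTorusLimitOfMixture (sectorGibbsCount n) (fun L => sectorGibbsWeightTT' β t t' U n L)
      (fun L => sectorGibbsVectorTT' t t' U n L) Ls)
    (hLs : Tendsto Ls atTop atTop) (hβ : 0 < β)
    {a a₀ : ℕ} (ha : 1 ≤ a) (ha₀ : a₀ ≤ a * a) {z : ℝ} (hz0 : 0 < z)
    (hz : z ≤ (partitionFn β (spinSectorHamiltonian a₀ a₀ (hubbardOpenBoxTT' a a t t' U))).re)
    (hbox : ∀ᶠ j in atTop, ∃ K, 2 ≤ K ∧ Ls j = K * a ∧ halfRectN n (Ls j) = K * K * a₀)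
    {s : ℝ} (hs : 2 * Real.binEntropy (n / 2) < s) :
    ω.meanEnergy (hubbardTTPrimeFermionInteraction t t' U) 1 ≤ (s - Real.log z / (a : ℝ) ^ 2) / β :=
  h.meanEnergy_hubbardTTPrime_le_entropy_sub_div_of_sectorGibbs hn0 hn2 hLs hβ
    (eventually_log_openBox_mul_sq_le_log_partitionFn t t' U n hβ.le ha ha₀ hz0 hz hbox)
    (hLs.eventually (eventually_log_sectorGibbsCount_le hn0 hn2 hs))

/-- **Certified upper bound on the thermal energy density from a box partition function and a hot
free-energy lower bound** (`0 < β_h < β`): with `ω`, `z`, the box data as above and an eventual bound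
`log Re Z_{β_h}(sectorHamiltonianTT' t t' U n L) ≤ u_h · L²` (a certified lower bound on the free energy per site
at the hotter `β_h` — from a high-temperature expansion or an entropy-constrained relaxation),
`e_{Φ(t,t',U)}(ω) ≤ (u_h − log z / a²)/(β − β_h)`. [cite: Ruelle1969, §2.5–2.6] [cite: Israel1979, Lemma II.3.1] -/
theorem IsTorusLimitOfMixture.meanEnergy_hubbardTTPrime_le_chord_openBox_of_sectorGibbs
    (hn0 : 0 ≤ n) (hn2 : n ≤ 2)
    (h : ω.IsTorusLimitOfMixture (sectorGibbsCount n) (fun L => sectorGibbsWeightTT' β t t' U n L)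
      (fun L => sectorGibbsVectorTT' t t' U n L) Ls)
    (hLs : Tendsto Ls atTop atTop) {βh : ℝ} (hβh : 0 < βh) (hlt : βh < β)
    {a a₀ : ℕ} (ha : 1 ≤ a) (ha₀ : a₀ ≤ a * a) {z : ℝ} (hz0 : 0 < z)
    (hz : z ≤ (partitionFn β (spinSectorHamiltonian a₀ a₀ (hubbardOpenBoxTT' a a t t' U))).re)
    (hbox : ∀ᶠ j in atTop, ∃ K, 2 ≤ K ∧ Ls j = K * a ∧ halfRectN n (Ls j) = K * K * a₀) {uh : ℝ}
    (huh : ∀ᶠ j in atTop, Real.log (partitionFn βh (sectorHamiltonianTT' t t' U n (Ls j))).re ≤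
      uh * (Ls j : ℝ) ^ 2) :
    ω.meanEnergy (hubbardTTPrimeFermionInteraction t t' U) 1 ≤ (uh - Real.log z / (a : ℝ) ^ 2) / (β - βh) :=
  h.meanEnergy_hubbardTTPrime_le_chord_of_sectorGibbs hn0 hn2 hLs hβh hlt
    (eventually_log_openBox_mul_sq_le_log_partitionFn t t' U n (hβh.le.trans hlt.le) ha ha₀ hz0 hz hbox) huh

end InfVolFermionState

/-! ### §4 The headline instance `n = 7/8`: `4 × 4` boxes with `(7, 7)` electrons, entropy constant `1.371` -/

section SevenEighths

/-- **Box arithmetic at filling `7/8`**: the canonical sector of the `4K × 4K` torus at `n = 7/8` is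
`K²`-fold the `(7↑, 7↓)` sector of a `4 × 4` box: `halfRectN (7/8) (4K) = 7K²` (the cluster/filling
bookkeeping of the `t–t'–U` cluster studies). [cite: LeBlancEtAl2015, eq. (1)] -/
theorem halfRectN_seven_eighths_four_mul (K : ℕ) : halfRectN (7 / 8) (4 * K) = K * K * 7 := by
  unfold halfRectN
  have h : (7 / 8 : ℝ) * ((4 * K : ℕ) : ℝ) ^ 2 / 2 = ((K * K * 7 : ℕ) : ℝ) := by
    push_cast; ring
  rw [h, Nat.floor_natCast]

/-- The tori `L_j = 4 (j + 2)` are built of `≥ 2 × 2` blocks of `4 × 4` boxes with `(7, 7)` electrons each at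
filling `7/8` (the hypothesis `hbox` of §3). [cite: LeBlancEtAl2015, eq. (1)] -/
theorem eventually_box_seven_eighths :
    ∀ᶠ j : ℕ in atTop, ∃ K, 2 ≤ K ∧ 4 * (j + 2) = K * 4 ∧ halfRectN (7 / 8) (4 * (j + 2)) = K * K * 7 :=
  Eventually.of_forall fun j => ⟨j + 2, by omega, by ring, halfRectN_seven_eighths_four_mul (j + 2)⟩

/-- `2 log 2 + (log 3)/2 + 1/98 ≤ log 7` (re-derived; private in `TorusSectorGibbsMixture` §6). [folklore] -/
private theorem two_mul_log_two_add_half_log_three_add_le_log_seven' :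
    2 * Real.log 2 + Real.log 3 / 2 + 1 / 98 ≤ Real.log 7 := by
  have h49 : Real.log 49 = 2 * Real.log 7 := by
    rw [show (49 : ℝ) = 7 ^ 2 by norm_num, Real.log_pow]; norm_num
  have h48 : Real.log 48 = 4 * Real.log 2 + Real.log 3 := by
    rw [show (48 : ℝ) = 2 ^ 4 * 3 by norm_num, Real.log_mul (by norm_num) (by norm_num), Real.log_pow]
    norm_num
  have hq : 1 - (49 / 48 : ℝ)⁻¹ ≤ Real.log (49 / 48) := Real.one_sub_inv_le_log_of_pos (by norm_num)
  have hdiv : Real.log (49 / 48) = Real.log 49 - Real.log 48 :=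
    Real.log_div (by norm_num) (by norm_num)
  rw [hdiv, h49, h48] at hq
  norm_num at hq
  linarith

/-- `2·H_b((7/8)/2) < 1371/1000` (re-derived; the entropy constant `s_max(7/8) = 2 H_b(7/16) = 1.3706…` of
`TorusSectorGibbsMixture` §6, private there). [folklore] -/
private theorem two_mul_binEntropy_half_seven_div_eight_lt :
    2 * Real.binEntropy (7 / 8 / 2) < 1371 / 1000 := by
  rw [show (7 / 8 / 2 : ℝ) = 7 / 16 by norm_num]
  have hid : 2 * Real.binEntropy (7 / 16) =
      8 * Real.log 2 - 7 / 8 * Real.log 7 - 9 / 4 * Real.log 3 := by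
    have h16 : Real.log 16 = 4 * Real.log 2 := by
      rw [show (16 : ℝ) = 2 ^ 4 by norm_num, Real.log_pow]; norm_num
    have h9 : Real.log 9 = 2 * Real.log 3 := by
      rw [show (9 : ℝ) = 3 ^ 2 by norm_num, Real.log_pow]; norm_num
    rw [Real.binEntropy, show (1 - 7 / 16 : ℝ) = 9 / 16 by norm_num, inv_div, inv_div,
      Real.log_div (by norm_num) (by norm_num), Real.log_div (by norm_num) (by norm_num), h16, h9]
    ring
  rw [hid]
  linarith [Real.log_two_lt_d9, Real.log_three_gt_d9,
    two_mul_log_two_add_half_log_three_add_le_log_seven']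

variable {t t' U β : ℝ} {ω : InfVolFermionState 2}

/-- **Headline producer at filling `7/8`** (torus-limit thermal convention, tori `L_j = 4(j+2)`): for every
torus limit `ω` of the canonical sector Gibbs states of the `t–t'` Hubbard model at `n = 7/8` and `β > 0`, and
every certified number `0 < z ≤ Re Z_β(H^open_{4×4}(t,t',U); 7, 7)` (the canonical partition function of the
OPEN `4 × 4` cluster with `7` up and `7` down electrons — or any Peierls lower bound for it),
`e_{Φ(t,t',U)}(ω) ≤ (1.371 − log z / 16)/β`. [cite: Israel1979, Lemma II.3.1] [cite: Ruelle1969, §2.5–2.6] -/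
theorem InfVolFermionState.IsTorusLimitOfMixture.meanEnergy_hubbardTTPrime_le_of_openBox_seven_eighths
    (h : ω.IsTorusLimitOfMixture (sectorGibbsCount (7 / 8))
      (fun L => sectorGibbsWeightTT' β t t' U (7 / 8) L) (fun L => sectorGibbsVectorTT' t t' U (7 / 8) L)
      (fun j => 4 * (j + 2)))
    (hβ : 0 < β) {z : ℝ} (hz0 : 0 < z)
    (hz : z ≤ (partitionFn β (spinSectorHamiltonian 7 7 (hubbardOpenBoxTT' 4 4 t t' U))).re) :
    ω.meanEnergy (hubbardTTPrimeFermionInteraction t t' U) 1 ≤ (1371 / 1000 - Real.log z / 16) / β := by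
  have hLs : Tendsto (fun j : ℕ => 4 * (j + 2)) atTop atTop :=
    tendsto_id.const_mul_atTop' (by norm_num) |>.comp (tendsto_add_atTop_nat 2)
  have h16 : ((4 : ℕ) : ℝ) ^ 2 = 16 := by norm_num
  have h := h.meanEnergy_hubbardTTPrime_le_entropy_sub_log_openBox_div_of_sectorGibbs
    (by norm_num : (0 : ℝ) ≤ 7 / 8) (by norm_num : (7 / 8 : ℝ) ≤ 2) hLs hβ (a := 4) (a₀ := 7) (by norm_num)
    (by norm_num) hz0 hz eventually_box_seven_eighths two_mul_binEntropy_half_seven_div_eight_lt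
  rw [h16] at h
  exact h

end SevenEighths

end Literature.MathematicalPhysics.QuantumLattice
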